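import Summits.BirchSwinnertonDyer.BirchSwinnertonDyer.Theorems.KolyvaginRoadThreeZhangTriangulationBasis
import Mathlib.Order.Interval.Finset.Nat
import Mathlib.Data.Fintype.EquivFin
import HarnessLib

/-!
# Route `KolyvaginRoadThree`, deciding crux `ZhangSharpFrameAtThreeHL` (item stmt-BirchSwinnertonDyer-19574):
# W. Zhang's TRIANGULAR BASIS of Kolyvagin classes (Camb. J. Math. 2 (2014), Lemma 8.4 (2)) as `p`-uniform linear
# algebra — part 2: the configuration `ℓ₁, …, ℓ_{2ν+1}` and `dim Sel^{ε_ν} ≥ ν + 1`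
# (cell `bsd-stepL`, ACCEL seat `bsd-stepL-koly3b` g3; `--supports stmt-BirchSwinnertonDyer-19574`, helper; companion
# of `KolyvaginRoadThreeZhangTriangulationBasis.lean`, whose module docstring fixes the abstract data and the INPUT
# SHAPES (REC) ∕ (Cheb) ∕ (Supply) ∕ (Perf) ∕ (Line) ∕ (Iso))

HONEST FRAMING. Pure linear algebra over an arbitrary field; nothing about elliptic curves, Heegner points, level
raising or `p = 3` is asserted; every number-theoretic input is a named hypothesis shape; 0 definitions, 0 named
facts, 0 `sorry`. PARTITION: O2@3 (B10) × A1 × crux 19574 — none (composition-engine input discharged from axiom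
shapes; types nothing, closes nothing; T7).

THIS FILE. §1 bookkeeping of the windows `n_i = {ℓ_i, …, ℓ_{i+ν−1}}` of a sequence `f : ℕ → ι` of primes
(as `(Finset.Ico i (ν + i)).image f`; enumeration of the starting set, injectivity under `Function.update`, the
window after one slide). §2 THE CONFIGURATION (Zhang p. 237 «We first prove by induction that, if 0 ≤ j ≤ ν, there
exist a sequence of primes ℓ₁, …, ℓ_{ν+j} …» through p. 238 «We finally add a prime ℓ_{2ν+1}»): iterating the
sliding step `ZhangTriangulation.slide` `ν` times from a non-zero class on `ν` primes and closing with Lemma 8.1,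
distinct Kolyvagin primes `f 0, …, f (2ν)` with `loc_{f(ν+i)} c(n_i) ≠ 0` for `0 ≤ i ≤ ν` (`exists_configuration`).
§3 at the VANISHING ORDER `ν` (every class on fewer primes is zero) the localisation matrix
`(loc_{f(ν+j)} c(n_i))_{i,j}` is upper-triangular ((8.2): the entries below the diagonal are localisations on the
support of a minimal class), so the `ν + 1` classes `c(n_i)` are linearly independent Selmer classes of sign
`ε_ν = ε₀ ^^ Nat.bodd ν`: `ν + 1 ≤ dim Sel^{ε_ν}` (`succ_le_finrank_sel`) — the lower bound half of Lemma 8.4 (1).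

References: [cite: WZhang2014, Lemma 8.4 (2) and its proof, (8.2)–(8.5), pp. 236–238] [cite: McCallumLMS1991,
Prop. 3.1, Lemma 5.3] [cite: Kolyvagin1991MathAnn291, Thm. 3].
-/

namespace Summit.BirchSwinnertonDyer.Rank1Residual.X11b.Three.Koly.ZhangTriangulation

open Module Finset

variable {F : Type*} [Field F] {H : Type*} [AddCommGroup H] [Module F H]
variable {P : Type*} {Hv : P → Type*} [∀ v, AddCommGroup (Hv v)] [∀ v, Module F (Hv v)]
variable {ι : Type*}

/-! ## §1 Windows of a sequence of primes -/

/-- **Enumerating the starting set**: a finite set `m₀` is the first window `(Ico 0 #m₀).image f` of a sequence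
`f : ℕ → ι` injective on `[0, #m₀)` (values beyond are a fixed junk prime `ℓ₀`). [folklore] -/
theorem exists_enum [DecidableEq ι] (m₀ : Finset ι) (ℓ₀ : ι) :
    ∃ f : ℕ → ι, Set.InjOn f (Set.Iio m₀.card) ∧ (Finset.Ico 0 m₀.card).image f = m₀ := by
  classical
  refine ⟨fun t ↦ if h : t < m₀.card then ((m₀.equivFin.symm ⟨t, h⟩ : m₀) : ι) else ℓ₀, ?_, ?_⟩
  · intro a ha b hb hab
    have ha' : a < m₀.card := ha
    have hb' : b < m₀.card := hb
    simp only [dif_pos ha', dif_pos hb'] at hab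
    have h := m₀.equivFin.symm.injective (Subtype.ext hab)
    simpa using h
  · ext x
    constructor
    · intro hx
      obtain ⟨t, ht, rfl⟩ := Finset.mem_image.mp hx
      have ht' : t < m₀.card := (Finset.mem_Ico.mp ht).2
      simp only [dif_pos ht']
      exact Subtype.coe_prop _
    · intro hx
      refine Finset.mem_image.mpr ⟨(m₀.equivFin ⟨x, hx⟩ : ℕ),
        Finset.mem_Ico.mpr ⟨Nat.zero_le _, Fin.isLt _⟩, ?_⟩
      simp only [dif_pos (Fin.isLt _), Fin.eta, Equiv.symm_apply_apply]

/-- **Adding a fresh prime keeps the sequence injective**: if `f` is injective on `[0, N)` and `ℓ'` is none of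
`f 0, …, f (N-1)`, then `f` updated at `N` by `ℓ'` is injective on `[0, N+1)`. [folklore] -/
theorem injOn_update [DecidableEq ι] {f : ℕ → ι} {N : ℕ} (hf : Set.InjOn f (Set.Iio N)) {ℓ' : ι}
    (hℓ' : ℓ' ∉ (Finset.range N).image f) : Set.InjOn (Function.update f N ℓ') (Set.Iio (N + 1)) := by
  intro a ha b hb hab
  have ha' : a < N + 1 := ha
  have hb' : b < N + 1 := hb
  by_cases haN : a = N
  · by_cases hbN : b = N
    · rw [haN, hbN]
    · subst haN
      rw [Function.update_self, Function.update_of_ne hbN] at hab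
      exact absurd (Finset.mem_image.mpr ⟨b, Finset.mem_range.mpr (by omega), hab.symm⟩) hℓ'
  · by_cases hbN : b = N
    · subst hbN
      rw [Function.update_self, Function.update_of_ne haN] at hab
      exact absurd (Finset.mem_image.mpr ⟨a, Finset.mem_range.mpr (by omega), hab⟩) hℓ'
    · rw [Function.update_of_ne haN, Function.update_of_ne hbN] at hab
      exact hf (show a < N by omega) (show b < N by omega) hab

/-- A window of an injective stretch has `ν` elements. [folklore] -/
theorem card_window [DecidableEq ι] {f : ℕ → ι} {N ν i : ℕ} (hf : Set.InjOn f (Set.Iio N)) (hi : ν + i ≤ N) :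
    ((Finset.Ico i (ν + i)).image f).card = ν := by
  rw [Finset.card_image_of_injOn, Nat.card_Ico, Nat.add_sub_cancel]
  intro a ha b hb hab
  have ha' := (Finset.mem_Ico.mp (Finset.mem_coe.mp ha)).2
  have hb' := (Finset.mem_Ico.mp (Finset.mem_coe.mp hb)).2
  exact hf (show a < N by omega) (show b < N by omega) hab

/-- Membership of a term of an injective stretch in a window is read on the index. [folklore] -/
theorem apply_mem_window_iff [DecidableEq ι] {f : ℕ → ι} {N ν i t : ℕ} (hf : Set.InjOn f (Set.Iio N))
    (hi : ν + i ≤ N) (ht : t < N) : f t ∈ (Finset.Ico i (ν + i)).image f ↔ i ≤ t ∧ t < ν + i := by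
  constructor
  · intro h
    obtain ⟨u, hu, hfu⟩ := Finset.mem_image.mp h
    have hu' := Finset.mem_Ico.mp hu
    have hut : u = t := hf (show u < N by omega) ht hfu
    omega
  · intro h
    exact Finset.mem_image.mpr ⟨t, Finset.mem_Ico.mpr h, rfl⟩

/-- Windows only see the values of the sequence on their index range. [folklore] -/
theorem window_congr [DecidableEq ι] {f g : ℕ → ι} {ν i : ℕ} (h : ∀ t, i ≤ t → t < ν + i → f t = g t) :
    (Finset.Ico i (ν + i)).image f = (Finset.Ico i (ν + i)).image g :=
  Finset.image_congr fun t ht ↦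
    h t (Finset.mem_Ico.mp (Finset.mem_coe.mp ht)).1 (Finset.mem_Ico.mp (Finset.mem_coe.mp ht)).2

/-- Dropping the oldest prime of a window: `n_j ∖ {ℓ_j} = {ℓ_{j+1}, …, ℓ_{ν+j−1}}`. [folklore] -/
theorem window_erase [DecidableEq ι] {f : ℕ → ι} {N ν j : ℕ} (hf : Set.InjOn f (Set.Iio N)) (hj : ν + j ≤ N)
    (hν : 0 < ν) : ((Finset.Ico j (ν + j)).image f).erase (f j) = (Finset.Ico (j + 1) (ν + j)).image f := by
  have hIco : Finset.Ico j (ν + j) = insert j (Finset.Ico (j + 1) (ν + j)) := by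
    rw [Nat.Ico_succ_left_eq_erase_Ico, Finset.insert_erase (Finset.mem_Ico.mpr ⟨le_rfl, by omega⟩)]
  rw [hIco, Finset.image_insert, Finset.erase_insert]
  intro h
  obtain ⟨u, hu, hfu⟩ := Finset.mem_image.mp h
  have hu' := Finset.mem_Ico.mp hu
  have huj : u = j := hf (show u < N by omega) (show j < N by omega) hfu
  omega

/-- The next window after updating the sequence at `ν + j` by the fresh prime `ℓ'`:
`n_{j+1} = (n_j ∖ {ℓ_j}) ∪ {ℓ'}`. [folklore] -/
theorem window_update [DecidableEq ι] {f : ℕ → ι} {ν j : ℕ} (ℓ' : ι) (hν : 0 < ν) :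
    (Finset.Ico (j + 1) (ν + (j + 1))).image (Function.update f (ν + j) ℓ') =
      insert ℓ' ((Finset.Ico (j + 1) (ν + j)).image f) := by
  have h1 : ν + (j + 1) = (ν + j) + 1 := by omega
  rw [h1, Nat.Ico_succ_right_eq_insert_Ico (by omega : j + 1 ≤ ν + j), Finset.image_insert,
    Function.update_self]
  congr 1
  refine Finset.image_congr fun t ht ↦ Function.update_of_ne ?_ _ _
  have := (Finset.mem_Ico.mp (Finset.mem_coe.mp ht)).2
  omega

/-! ## §2 The configuration of Lemma 8.4 (2) -/

/-- **The primes `ℓ₁, …, ℓ_{2ν+1}` of Lemma 8.4 (2).** Data and input shapes as in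
`KolyvaginRoadThreeZhangTriangulationBasis.lean` (here additionally (Cheb) for ONE non-zero class, `hCheb1`). If some
class on `ν` primes is non-zero, there is a sequence `f` of Kolyvagin primes, injective on `[0, 2ν+1)`, whose windows
`n_i = {f i, …, f (ν+i−1)}` (`0 ≤ i ≤ ν`) satisfy `loc_{f(ν+i)} c(n_i) ≠ 0` — the DIAGONAL of (8.2); in particular
every `c(n_i) ≠ 0`. Proof = the source's induction on `j` (p. 237) with `ZhangTriangulation.slide` as the step and
Lemma 8.1 for the last prime (p. 238). Minimality of `ν` is not used here. [cite: WZhang2014, Lemma 8.4 (2), proof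
pp. 237–238] [cite: McCallumLMS1991, Prop. 3.1, Lemma 5.3] -/
theorem exists_configuration [DecidableEq ι] [DecidableEq P] (E : Bool → Submodule F H)
    (loc : (v : P) → H →ₗ[F] Hv v) (b : (v : P) → Hv v →ₗ[F] Hv v →ₗ[F] F) (L : (v : P) → Submodule F (Hv v))
    (pl : ι → P) (Fv Tv : (ℓ : ι) → Submodule F (Hv (pl ℓ))) (c : Finset ι → H) (ε₀ : Bool)
    (hpl : Function.Injective pl)
    (hLF : ∀ ℓ, L (pl ℓ) = Fv ℓ)
    (hisoL : ∀ (v : P), ∀ x ∈ L v, ∀ y ∈ L v, b v x y = 0)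
    (hisoT : ∀ (ℓ : ι), ∀ x ∈ Tv ℓ, ∀ y ∈ Tv ℓ, b (pl ℓ) x y = 0)
    (hperf : ∀ (ℓ : ι) (s : Bool), ∀ x ∈ E s, ∀ y ∈ E s, loc (pl ℓ) x ∈ Fv ℓ → loc (pl ℓ) x ≠ 0 →
      loc (pl ℓ) y ∈ Tv ℓ → loc (pl ℓ) y ≠ 0 → b (pl ℓ) (loc (pl ℓ) x) (loc (pl ℓ) y) ≠ 0)
    (hrec : ∀ (x y : H) (T : Finset P), (∀ v, v ∉ T → b v (loc v x) (loc v y) = 0) →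
      ∑ v ∈ T, b v (loc v x) (loc v y) = 0)
    (hcE : ∀ m : Finset ι, c m ∈ E (ε₀ ^^ Nat.bodd m.card))
    (hcL : ∀ (m : Finset ι) (v : P), (∀ ℓ ∈ m, pl ℓ ≠ v) → loc v (c m) ∈ L v)
    (hcT : ∀ (m : Finset ι), ∀ ℓ ∈ m, loc (pl ℓ) (c m) ∈ Tv ℓ)
    (hfs : ∀ (m : Finset ι) (ℓ : ι), ℓ ∉ m → (loc (pl ℓ) (c (insert ℓ m)) = 0 ↔ loc (pl ℓ) (c m) = 0))
    (hCheb1 : ∀ x : H, x ≠ 0 → ∀ S : Finset ι, ∃ ℓ, ℓ ∉ S ∧ loc (pl ℓ) x ≠ 0)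
    (hCheb2 : ∀ (s : Bool), ∀ x ∈ E s, ∀ y ∈ E (!s), x ≠ 0 → y ≠ 0 → ∀ S : Finset ι,
      ∃ ℓ, ℓ ∉ S ∧ loc (pl ℓ) x ≠ 0 ∧ loc (pl ℓ) y ≠ 0)
    (hSupply : ∀ (ℓ : ι) (S : Finset ι), ℓ ∉ S → ∀ s : Bool, ∃ x ∈ E s, x ≠ 0 ∧
      (∀ v : P, v ≠ pl ℓ → (∀ ℓ' ∈ S, pl ℓ' ≠ v) → loc v x ∈ L v) ∧ ∀ ℓ' ∈ S, loc (pl ℓ') x ∈ Tv ℓ')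
    {ν : ℕ} (hν : ∃ m : Finset ι, m.card = ν ∧ c m ≠ 0) :
    ∃ f : ℕ → ι, Set.InjOn f (Set.Iio (2 * ν + 1)) ∧
      ∀ i ≤ ν, loc (pl (f (ν + i))) (c ((Finset.Ico i (ν + i)).image f)) ≠ 0 := by
  obtain ⟨m₀, hm₀, hcm₀⟩ := hν
  obtain ⟨ℓ₀, -, -⟩ := hCheb1 (c m₀) hcm₀ ∅
  -- the induction of p. 237: after j slides
  have key : ∀ j ≤ ν, ∃ f : ℕ → ι, Set.InjOn f (Set.Iio (ν + j)) ∧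
      c ((Finset.Ico j (ν + j)).image f) ≠ 0 ∧
      ∀ i < j, loc (pl (f (ν + i))) (c ((Finset.Ico i (ν + i)).image f)) ≠ 0 := by
    intro j
    induction j with
    | zero =>
      intro _
      obtain ⟨f, hf, hfm⟩ := exists_enum m₀ ℓ₀
      refine ⟨f, ?_, ?_, fun i hi ↦ absurd hi (Nat.not_lt_zero i)⟩
      · rw [Nat.add_zero, ← hm₀]
        exact hf
      · rw [Nat.add_zero, ← hm₀, hfm]
        exact hcm₀
    | succ j ih =>
      intro hj
      obtain ⟨f, hf, hcW, hdiag⟩ := ih (Nat.le_of_succ_le hj)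
      have hν : 0 < ν := by omega
      have hcard : ((Finset.Ico j (ν + j)).image f).card = ν := card_window hf le_rfl
      have hmem : f j ∈ (Finset.Ico j (ν + j)).image f :=
        Finset.mem_image.mpr ⟨j, Finset.mem_Ico.mpr ⟨le_rfl, by omega⟩, rfl⟩
      obtain ⟨ℓ', hℓ'S, -, hℓ'c, hc'⟩ := slide E loc b L pl Fv Tv c ε₀ hpl hLF hisoL hisoT hperf hrec hcE
        hcL hcT hfs hCheb2 hSupply hcard hcW hmem ((Finset.range (ν + j)).image f)
      refine ⟨Function.update f (ν + j) ℓ', injOn_update hf hℓ'S, ?_, ?_⟩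
      · rw [window_update ℓ' hν, ← window_erase hf le_rfl hν]
        exact hc'
      · intro i hi
        rcases Nat.lt_succ_iff_lt_or_eq.mp hi with hi | rfl
        · rw [Function.update_of_ne (by omega : ν + i ≠ ν + j),
            window_congr (g := f) (fun t _ ht ↦ Function.update_of_ne (by omega) _ _)]
          exact hdiag i hi
        · rw [Function.update_self, window_congr (g := f) (fun t _ ht ↦ Function.update_of_ne (by omega) _ _)]
          exact hℓ'c
  -- the last prime ℓ_{2ν+1} (p. 238): seen by c(n_{ν+1})
  obtain ⟨f, hf, hcW, hdiag⟩ := key ν le_rfl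
  obtain ⟨ℓ'', hℓ''S, hℓ''c⟩ := hCheb1 _ hcW ((Finset.range (ν + ν)).image f)
  refine ⟨Function.update f (ν + ν) ℓ'', ?_, ?_⟩
  · have h := injOn_update hf hℓ''S
    rwa [show 2 * ν + 1 = ν + ν + 1 by omega]
  · intro i hi
    rcases Nat.lt_or_eq_of_le hi with hi | rfl
    · rw [Function.update_of_ne (by omega : ν + i ≠ ν + ν),
        window_congr (g := f) (fun t _ ht ↦ Function.update_of_ne (by omega) _ _)]
      exact hdiag i hi
    · rw [Function.update_self, window_congr (g := f) (fun t _ ht ↦ Function.update_of_ne (by omega) _ _)]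
      exact hℓ''c

/-! ## §3 At the vanishing order: upper-triangularity and `ν + 1 ≤ dim Sel^{ε_ν}` -/

/-- **Below the diagonal the localisation matrix vanishes** ((8.2), `i > j`): for `j < i ≤ ν` the prime
`f (ν+j)` lies in the window `n_i`, and at the vanishing order a class on `ν` primes vanishes locally on its support
(`loc_eq_zero_of_mem_of_card_eq`). [cite: WZhang2014, Lemma 8.4 (2), (8.2)] -/
theorem loc_window_eq_zero_of_lt [DecidableEq ι] (loc : (v : P) → H →ₗ[F] Hv v) (pl : ι → P) (c : Finset ι → H)
    (hfs : ∀ (m : Finset ι) (ℓ : ι), ℓ ∉ m → (loc (pl ℓ) (c (insert ℓ m)) = 0 ↔ loc (pl ℓ) (c m) = 0))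
    {ν : ℕ} (hmin : ∀ m : Finset ι, m.card < ν → c m = 0)
    {f : ℕ → ι} (hf : Set.InjOn f (Set.Iio (2 * ν + 1))) {i j : ℕ} (hji : j < i) (hi : i ≤ ν) :
    loc (pl (f (ν + j))) (c ((Finset.Ico i (ν + i)).image f)) = 0 := by
  refine loc_eq_zero_of_mem_of_card_eq loc pl c hfs hmin (card_window hf (by omega)) ?_
  exact (apply_mem_window_iff hf (by omega) (by omega)).mpr ⟨by omega, by omega⟩

/-- **The `ν + 1` window classes are linearly independent** («It is clearly c(nᵢ) … are linearly independent», p.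
238): upper-triangular localisation matrix with non-zero diagonal. [cite: WZhang2014, Lemma 8.4 (2), (8.2)] -/
theorem linearIndependent_windows [DecidableEq ι] (loc : (v : P) → H →ₗ[F] Hv v) (pl : ι → P)
    (c : Finset ι → H)
    (hfs : ∀ (m : Finset ι) (ℓ : ι), ℓ ∉ m → (loc (pl ℓ) (c (insert ℓ m)) = 0 ↔ loc (pl ℓ) (c m) = 0))
    {ν : ℕ} (hmin : ∀ m : Finset ι, m.card < ν → c m = 0)
    {f : ℕ → ι} (hf : Set.InjOn f (Set.Iio (2 * ν + 1)))
    (hdiag : ∀ i ≤ ν, loc (pl (f (ν + i))) (c ((Finset.Ico i (ν + i)).image f)) ≠ 0) :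
    LinearIndependent F (fun i : Fin (ν + 1) ↦ c ((Finset.Ico (i : ℕ) (ν + i)).image f)) :=
  linearIndependent_of_triangular (ν + 1) (fun i ↦ c ((Finset.Ico i (ν + i)).image f))
    (T := fun j ↦ Hv (pl (f (ν + j)))) (fun j ↦ loc (pl (f (ν + j))))
    (fun _ _ hji hi ↦ loc_window_eq_zero_of_lt loc pl c hfs hmin hf hji (Nat.lt_succ_iff.mp hi))
    (fun j hj ↦ hdiag j (Nat.lt_succ_iff.mp hj))

/-- **`ν + 1 ≤ dim Sel^{ε_ν}`** (half of Lemma 8.4 (1)): the `ν + 1` window classes are linearly independent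
members of `Sel (ε₀ ^^ Nat.bodd ν)` (`mem_sel_of_card_eq`). `Sel` is any subspace with the printed membership
`x ∈ Sel s ↔ x ∈ E s ∧ ∀ v, loc_v x ∈ L v`, assumed finite-dimensional. [cite: WZhang2014, Lemma 8.4 (1)–(2)] -/
theorem succ_le_finrank_sel [DecidableEq ι] (E : Bool → Submodule F H) (loc : (v : P) → H →ₗ[F] Hv v)
    (L : (v : P) → Submodule F (Hv v)) (pl : ι → P) (c : Finset ι → H) (ε₀ : Bool)
    (Sel : Bool → Submodule F H) (hSel : ∀ (s : Bool) (x : H), x ∈ Sel s ↔ x ∈ E s ∧ ∀ v, loc v x ∈ L v)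
    (hcE : ∀ m : Finset ι, c m ∈ E (ε₀ ^^ Nat.bodd m.card))
    (hcL : ∀ (m : Finset ι) (v : P), (∀ ℓ ∈ m, pl ℓ ≠ v) → loc v (c m) ∈ L v)
    (hfs : ∀ (m : Finset ι) (ℓ : ι), ℓ ∉ m → (loc (pl ℓ) (c (insert ℓ m)) = 0 ↔ loc (pl ℓ) (c m) = 0))
    {ν : ℕ} [FiniteDimensional F (Sel (ε₀ ^^ Nat.bodd ν))] (hmin : ∀ m : Finset ι, m.card < ν → c m = 0)
    {f : ℕ → ι} (hf : Set.InjOn f (Set.Iio (2 * ν + 1)))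
    (hdiag : ∀ i ≤ ν, loc (pl (f (ν + i))) (c ((Finset.Ico i (ν + i)).image f)) ≠ 0) :
    ν + 1 ≤ finrank F (Sel (ε₀ ^^ Nat.bodd ν)) := by
  have hmem : ∀ i : Fin (ν + 1), c ((Finset.Ico (i : ℕ) (ν + i)).image f) ∈ Sel (ε₀ ^^ Nat.bodd ν) :=
    fun i ↦ mem_sel_of_card_eq E loc L pl c ε₀ Sel hSel hcE hcL hfs hmin
      (card_window hf (by have := i.isLt; omega))
  have hli := linearIndependent_windows loc pl c hfs hmin hf hdiag
  have hli' : LinearIndependent F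
      (fun i : Fin (ν + 1) ↦ (⟨c ((Finset.Ico (i : ℕ) (ν + i)).image f), hmem i⟩ : Sel (ε₀ ^^ Nat.bodd ν))) :=
    LinearIndependent.of_comp (Sel (ε₀ ^^ Nat.bodd ν)).subtype hli
  have h := hli'.fintype_card_le_finrank
  rwa [Fintype.card_fin] at h

end Summit.BirchSwinnertonDyer.Rank1Residual.X11b.Three.Koly.ZhangTriangulation
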